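import Mathlib
import Literature.Computability.QuantumComplexity.SinkOfVerifiableLine
import Literature.Computability.QuantumComplexity.SpectralAdversary
import Summits.QuantumAdvantage.QuantumAdvantage.Theses.WhiteBoxWalk

/-!
# Sketch — crux-ideate stmt-QuantumAdvantage-2239 (`WbwVerifiableLineNoSpeedup`), ideator 1, round 1

First lemmas of the two idea cards, stated over existing declarations (no proofs; `def … : Prop`
only, so the file is sorry-free):

* card `cycle-surgery-adversary`: `RelationalAdversaryBound` (Ambainis 2002 Thm 6 in
  average-degree form for the tree's `QQueryAlg`, constant `144` as in `SpectralAdversary.lean`),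
  the SVL instance of a permutation `permInstance`, the surgery `surgery`, and the two SVL-side
  statements `SvlPairProducts` / `SvlAverageDegree` it is fed with; `cruxShape` records the
  target inequality they combine to.
* card `lazy-verifier-permutation-oracle`: `UniqueBackChainBound` (lazy sampling of a random
  permutation through a recorded partial injection: `Pr[S^i(a) = x ∣ D] ≤ 2/(N - |D| - i)`).
-/

noncomputable section

open scoped BigOperators Classical

namespace Summit.QuantumAdvantage.QuantumAdvantage.Cruxes.WbwVerifiableLineNoSpeedup.Ideator1

open Literature.Computability.Cryptography Literature.Computability.QuantumComplexity

/-! ## Card 1 — cycle-surgery adversary -/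

/-- **First lemma (card cycle-surgery-adversary).** Ambainis's relational adversary bound
(JCSS 64 (2002), Thm 6) for the tree's query model, in AVERAGE-degree form (which is what
Ambainis's proof gives: the initial progress is `|R| / (2 √(|X| |Y|))`): if `A` computes `f` with
error `1/3` on `D`, `R ⊆ X × Y` relates `D`-inputs with different `f`-values, and for every
related pair `(x, y)` and every bit `i` with `x i ≠ y i` the product
`#{y' : (x, y') ∈ R, x i ≠ y' i} · #{x' : (x', y) ∈ R, x' i ≠ y i}` is at most `L`, then
`|R| ≤ 144 · T · √L · √(|X| · |Y|)`, i.e. `T ≥ |R| / (144 √(L |X| |Y|))`.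
Proof route: the progress function of `SpectralAdversary.lean` with weights
`α_x = 1/√(2|X|)`, `α_y = 1/√(2|Y|)` on the pairs of `R`; one query changes it by at most `√L`
(Cauchy–Schwarz with the weights `√(l_{y,i} / l_{x,i})`, Ambainis's proof of Thm 6); the final
value is at most `(1 - 1/72)` of the initial one (`SpectralAdversary.rinner_le_of_gap`). -/
def RelationalAdversaryBound : Prop :=
  ∀ (N : ℕ) (A : QQueryAlg N) (D : Set (Fin N → Bool)) (f : (Fin N → Bool) → Bool),
    A.ComputesWithError (1 / 3) D f →
    ∀ (X Y : Finset (Fin N → Bool)) (R : Finset ((Fin N → Bool) × (Fin N → Bool))) (L : ℝ),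
      (∀ p ∈ R, p.1 ∈ X ∧ p.2 ∈ Y ∧ p.1 ∈ D ∧ p.2 ∈ D ∧ f p.1 ≠ f p.2) →
      (∀ p ∈ R, ∀ i : Fin N, p.1 i ≠ p.2 i →
        ((R.filter fun q => q.1 = p.1 ∧ q.1 i ≠ q.2 i).card : ℝ) *
            ((R.filter fun q => q.2 = p.2 ∧ q.1 i ≠ q.2 i).card : ℝ) ≤ L) →
      (R.card : ℝ) ≤ 144 * A.queries * Real.sqrt L * Real.sqrt ((X.card : ℝ) * Y.card)

variable {m T : ℕ}

/-- The source name `0ᵐ`. -/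
def src (m : ℕ) : Fin (2 ^ m) := ⟨0, Nat.two_pow_pos m⟩

/-- The would-be line of a permutation `S` of the names: `x_i = S^i(0)`, `i ≤ T`. -/
def lineOf (m T : ℕ) (S : Equiv.Perm (Fin (2 ^ m))) (i : Fin (T + 1)) : Fin (2 ^ m) :=
  (S ^ (i : ℕ)) (src m)

/-- `S` is admissible iff its first `T+1` orbit points from `0` are distinct (the cycle of `0` has
length `≥ T + 1`). -/
def Admissible (m T : ℕ) (S : Equiv.Perm (Fin (2 ^ m))) : Prop :=
  Function.Injective (lineOf m T S)

/-- The SVL instance of a permutation: S-table `= S`, V marks the orbit of `0`: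
`V(x, i) = [x = S^i(0)]`. -/
def permInstance (m T : ℕ) (S : Equiv.Perm (Fin (2 ^ m))) : SVLInput m T :=
  svlInput m T S fun x i => decide (x = lineOf m T S i)

/-- The cycle surgery: `S ∘ swap(a, b)`, i.e. `S'(a) = S(b)`, `S'(b) = S(a)`, all other values
unchanged (exactly two S-rows change). -/
def surgery {n : ℕ} (S : Equiv.Perm (Fin n)) (a b : Fin n) : Equiv.Perm (Fin n) :=
  S * Equiv.swap a b

/-- The parity of the sink of (the instance of) `S`. -/
def sinkOdd (m T : ℕ) (S : Equiv.Perm (Fin (2 ^ m))) : Bool :=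
  decide ((lineOf m T S (Fin.last T)).val % 2 = 1)

/-- `(S, S')` is a surgery pair of the relation `R'`: `S' = S ∘ swap(x_j, z)` with `j < T`, `z` off
the line of `S`, both admissible, sink parities different, and the surgery is a LONG MERGE
(`z` not on the cycle of `0` and its cycle longer than `T - j`) or a FAR SPLIT (`z = S^p(0)` with
`T < p`). (Admissibility of `S'` encodes validity of the split.) -/
def IsSurgeryPair (m T : ℕ) (S S' : Equiv.Perm (Fin (2 ^ m))) : Prop :=
  Admissible m T S ∧ Admissible m T S' ∧ sinkOdd m T S ≠ sinkOdd m T S' ∧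
    ∃ (j : ℕ) (z : Fin (2 ^ m)), j < T ∧ (∀ i : Fin (T + 1), z ≠ lineOf m T S i) ∧
      S' = surgery S ((S ^ j) (src m)) z ∧
      ((¬ Equiv.Perm.SameCycle S (src m) z ∧ T - j < (S.cycleOf z).support.card) ∨
        (∃ p : ℕ, T < p ∧ z = (S ^ p) (src m)))

/-- The relation as a finite set of instance pairs (even sink on the left, odd on the right). -/
def surgeryRel (m T : ℕ) : Finset (SVLInput m T × SVLInput m T) :=
  (Finset.univ.filter fun SS' : Equiv.Perm (Fin (2 ^ m)) × Equiv.Perm (Fin (2 ^ m)) =>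
      IsSurgeryPair m T SS'.1 SS'.2 ∧ sinkOdd m T SS'.1 = false).image
    fun SS' => (permInstance m T SS'.1, permInstance m T SS'.2)

/-- The two sides of the relation. -/
def evenSide (m T : ℕ) : Finset (SVLInput m T) :=
  (Finset.univ.filter fun S : Equiv.Perm (Fin (2 ^ m)) =>
      Admissible m T S ∧ sinkOdd m T S = false).image (permInstance m T)

/-- The odd side. -/
def oddSide (m T : ℕ) : Finset (SVLInput m T) :=
  (Finset.univ.filter fun S : Equiv.Perm (Fin (2 ^ m)) =>
      Admissible m T S ∧ sinkOdd m T S = true).image (permInstance m T)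

/-- **SVL combinatorics, part 1 (per-pair products).** For every surgery pair and every input
bit where the two instances differ, the Ambainis product is at most `max (N², T²·N)`,
`N = 2^m`: S-row `x_j`: `≤ N · N`; S-row `z`: `≤ T · N`; V-cells `(x_k, k)`, `(x'_k, k)`,
`k > j`: `≤ (T·N) · T` (a partner re-marks a given V-cell only by re-inserting the excised /
merged cycle at one of `≤ T` positions — this is where LONG merges and FAR splits are needed). -/
def SvlPairProducts : Prop :=
  ∀ m T : ℕ, 1 ≤ T → T + 1 ≤ 2 ^ (m - 1) →
    ∀ p ∈ surgeryRel m T, ∀ i : Fin (2 ^ m * m + 2 ^ m * (T + 1)), p.1 i ≠ p.2 i →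
      (((surgeryRel m T).filter fun q => q.1 = p.1 ∧ q.1 i ≠ q.2 i).card : ℝ) *
          (((surgeryRel m T).filter fun q => q.2 = p.2 ∧ q.1 i ≠ q.2 i).card : ℝ) ≤
        max ((2 : ℝ) ^ m * 2 ^ m) (((T : ℝ) ^ 2) * 2 ^ m)

/-- **SVL combinatorics, part 2 (average degree).** The relation has average degree `≥ c₀·T·N`:
`|R'| ≥ c₀ · T · 2^m · √(|even| · |odd|)` for an absolute `c₀ > 0` (from `E[# points off the
`0`-cycle on cycles longer than `s`] = M - s` for a uniform permutation of `M` points, the uniform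
law of the `0`-cycle length, and parity symmetrisation by conjugating with `Stab(0)`). -/
def SvlAverageDegree : Prop :=
  ∃ c₀ : ℝ, 0 < c₀ ∧ ∀ m T : ℕ, 4 ≤ m → 1 ≤ T → T + 1 ≤ 2 ^ (m - 1) →
    c₀ * T * 2 ^ m * Real.sqrt (((evenSide m T).card : ℝ) * (oddSide m T).card) ≤
      ((surgeryRel m T).card : ℝ)

/-- The shape the three statements combine to (via `permInstance S ∈ svlPromise` for admissible
`S`, `svlSinkBit (permInstance S) = sinkOdd S`, `exists_queries_eq_quantumQueryComplexityOn`,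
and `Disproof.one_le_svlQ_of_hyps` for the finitely many small `m`): the crux WITHOUT the `1/m`. -/
def cruxShape : Prop :=
  ∃ c : ℝ, 0 < c ∧ ∀ m T : ℕ, 2 ≤ m → 1 ≤ T → T + 1 ≤ 2 ^ (m - 1) →
    c * min ((T : ℝ) + 1) (Real.sqrt (2 ^ m)) ≤
      (quantumQueryComplexityOn (1 / 3) (svlPromise m T) (svlSinkBit m T) : ℝ)

/-- The shape implies the crux (the `1/m` only weakens: `m ≥ 1`, both sides nonnegative). -/
theorem crux_of_cruxShape (h : cruxShape) :
    Summit.QuantumAdvantage.QuantumAdvantage.Theses.WhiteBoxWalk.WbwVerifiableLineNoSpeedup := by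
  obtain ⟨c, hc, H⟩ := h
  refine ⟨c, hc, fun m T hm hT hTm => ?_⟩
  have h1 := H m T hm hT hTm
  rw [← svlPromise_eq, ← svlSinkBit_eq]
  have hm1 : (1 : ℝ) ≤ m := by exact_mod_cast (le_trans (by norm_num) hm)
  have hnn : 0 ≤ c * min ((T : ℝ) + 1) (Real.sqrt (2 ^ m)) :=
    mul_nonneg hc.le (le_min (by positivity) (Real.sqrt_nonneg _))
  calc c * min ((T : ℝ) + 1) (Real.sqrt (2 ^ m)) / m
      ≤ c * min ((T : ℝ) + 1) (Real.sqrt (2 ^ m)) := div_le_self hnn hm1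
    _ ≤ _ := h1

/-! ## Card 2 — lazy verifier on a permutation superposition oracle -/

/-- **First lemma (card lazy-verifier-permutation-oracle).** Lazy sampling of a uniformly random
permutation through a recorded partial injection `D` (the database): if `a` has no recorded
image, then for every target `x` and every `i ≥ 1` with `|D| + i < N`,
`Pr_{S ⊇ D}[S^i(a) = x] ≤ 2 / (N - |D| - i)` — the walk from `a` reaches `x` at time `i` only by
a FRESH step landing on `x` itself or on the start of the unique recorded back-chain of `x` at
the one matching time, and a fresh step of a permutation never lands on a recorded image (the
"no funnel" property that fails for random functions). Stated as a counting inequality. -/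
def UniqueBackChainBound : Prop :=
  ∀ (N : ℕ) (D : Finset (Fin N × Fin N)),
    (∀ p ∈ D, ∀ q ∈ D, p.1 = q.1 → p = q) → (∀ p ∈ D, ∀ q ∈ D, p.2 = q.2 → p = q) →
    ∀ (a x : Fin N) (i : ℕ), (∀ p ∈ D, p.1 ≠ a) → 1 ≤ i → D.card + i < N →
      ((Finset.univ.filter fun S : Equiv.Perm (Fin N) =>
            (∀ p ∈ D, S p.1 = p.2) ∧ (S ^ i) a = x).card : ℝ) * ((N : ℝ) - D.card - i) ≤
        2 * ((Finset.univ.filter fun S : Equiv.Perm (Fin N) => ∀ p ∈ D, S p.1 = p.2).card : ℝ)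

end Summit.QuantumAdvantage.QuantumAdvantage.Cruxes.WbwVerifiableLineNoSpeedup.Ideator1

end
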